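import Summits.BirchSwinnertonDyer.BirchSwinnertonDyer.Theorems.Rank2ObservatoryKrausCert
import Summits.BirchSwinnertonDyer.BirchSwinnertonDyer.Theorems.Rank2ObservatoryRank3MinimalCensus2
import Summits.BirchSwinnertonDyer.BirchSwinnertonDyer.Theorems.Rank2ObservatoryRank3KrausCerts1
import Summits.BirchSwinnertonDyer.BirchSwinnertonDyer.Theorems.Rank2ObservatoryRank3KrausCerts2
import Summits.BirchSwinnertonDyer.BirchSwinnertonDyer.Theorems.Rank2ObservatoryRank3KrausCerts3
import HarnessLib

/-!
# BSD rank ≥ 2 observatory (`b2b-bsdr2`): the rank-3 census — GLOBAL MINIMALITY OF EVERY ROW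
# (kernel, one pass; no named fact, no hypothesis)

HONEST FRAMING: per-curve certified theorems and census instruments; no claim on BSD in rank ≥ 2.

**Every one of the `9487` equations of the rank-3 census (`rank3Table`, Cremona's models of the
rank-3 curves of conductor `< 500 000`) is a global minimal Weierstrass equation**, as a theorem with
no hypothesis: `Rank3Row.isGloballyMinimal_of_mem`. The kernel runs the total walker
`totalMinCheck` (`Rank2ObservatoryKrausCert`) ONCE over the table (in four consecutive segments,
one `decide +kernel` each) with three certificate sources (the two extra lists merged by `mergeIdx`) —
the aligned root-number certificates `rank3RNCerts` (`7143` rows: `RNCert.minCheck`, Silverman's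
criterion at every prime), the minimality-only list `rank3MinCerts` (`1420` rows additive at `3`:
`minCheck`), and the Kraus list `rank3KrausCerts` (`924` rows with `2¹² ∣ Δ`, `2⁴ ∣ c₄`: Kraus's
condition `2⁸ ∤ c₄ ∧ 2⁸ ∤ c₆ + 64` at `2` via the tree theorem
`isMinimalAt_baseChange_int_two_of_kraus`, Silverman at the odd primes) — `7143 + 1420 + 924 = 9487`.
Hence the census headline `Rank3Row.rank3_lderiv_eq_zero_kernel` loses its hypothesis `hmin` on
every row (`Rank3Row.rank3_lderiv_eq_zero_kernel₀`), and the fully certified form for the rows with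
root-number and conductor certificates is `Rank3Row.rank3_lderiv_eq_zero_kernel_rnN₀`. Census
coverage after this file: `hlow` `9487`, `hmin` `9487` (unconditional), `hw` `7937` (modulo `hKD`),
`hN` `5347` (modulo the five conductor facts), of `9487`.

Cross-checks outside the proof: `gen_kraus_certs.py` (924 certificates; Kraus and odd-prime conditions
from the a-invariants), `minimal_check.py`, PARI `ellminimalmodel` (job `j101307`, the job of record — it supersedes
`j100675`: every census model is minimal). References: Kraus 1989 Prop. 2 [Kraus1989]; Silverman *AEC* VII.1 Rem. 1.1, VIII.8
[SilvermanAEC2009]; Cremona 1997 §3.2 and Tables [CremonaAlgorithms1997]; Gross 1991 [GrossLMS1991].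
-/

set_option linter.dupNamespace false
set_option autoImplicit false

open WeierstrassCurve IsDedekindDomain Literature Literature.NumberTheory.EllipticCurves

namespace Summit.BirchSwinnertonDyer.BirchSwinnertonDyer.Rank2Observatory

open RootNumber

/-- All `924` Kraus certificates `(row index, certificate)`, indices increasing. [cite: Kraus1989, Prop. 2] -/
def rank3KrausCerts : List (ℕ × RNCert) :=
  rank3KrausCerts1 ++ rank3KrausCerts2 ++ rank3KrausCerts3

/-- `924` pairs (kernel). [cite: CremonaAlgorithms1997, Tables] -/
theorem rank3KrausCerts_length : rank3KrausCerts.length = 924 := by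
  decide +kernel

/-- The Kraus row indices are strictly increasing (kernel). [folklore] -/
theorem rank3KrausCerts_sorted : sortedLT (rank3KrausCerts.map Prod.fst) = true := by
  decide +kernel

/-- The `2344` extra certificates, merged by index and tagged (`false` = minimality-only, `true` =
Kraus). [folklore] -/
def rank3Extras : List (ℕ × Bool × RNCert) := mergeIdx 2344 rank3MinCerts rank3KrausCerts

/-- `2344 = 1420 + 924` merged entries (kernel). [folklore] -/
theorem rank3Extras_length : rank3Extras.length = 2344 := by
  decide +kernel

/-- **KERNEL CHECK, segment 1 (rows `0`–`2399`)** of the total minimality walker (the pass is cut in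
four segments only to keep each kernel evaluation within the default heartbeat budget).
[cite: SilvermanAEC2009, VII.1 Remark 1.1] [cite: Kraus1989, Prop. 2] -/
theorem rank3Table_totalMinCheck₁ :
    totalMinCheck (rank3Table.take 2400) (rank3RNCerts.take 2400) 0 rank3Extras = true := by
  decide +kernel

/-- **KERNEL CHECK, segment 2 (rows `2400`–`4799`).** [cite: SilvermanAEC2009, VII.1 Remark 1.1] -/
theorem rank3Table_totalMinCheck₂ :
    totalMinCheck ((rank3Table.drop 2400).take 2400) ((rank3RNCerts.drop 2400).take 2400) 2400
      (rank3Extras.dropWhile fun x => decide (x.1 < 2400)) = true := by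
  decide +kernel

/-- **KERNEL CHECK, segment 3 (rows `4800`–`7199`).** [cite: SilvermanAEC2009, VII.1 Remark 1.1] -/
theorem rank3Table_totalMinCheck₃ :
    totalMinCheck (((rank3Table.drop 2400).drop 2400).take 2400)
      (((rank3RNCerts.drop 2400).drop 2400).take 2400) 4800
      (rank3Extras.dropWhile fun x => decide (x.1 < 4800)) = true := by
  decide +kernel

/-- **KERNEL CHECK, segment 4 (rows `7200`–`9486`).** [cite: Kraus1989, Prop. 2] -/
theorem rank3Table_totalMinCheck₄ :
    totalMinCheck (((rank3Table.drop 2400).drop 2400).drop 2400)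
      (((rank3RNCerts.drop 2400).drop 2400).drop 2400) 7200
      (rank3Extras.dropWhile fun x => decide (x.1 < 7200)) = true := by
  decide +kernel

/-- **Every equation of the rank-3 census is a global minimal model** — no hypothesis.
[cite: SilvermanAEC2009, VII.1 Remark 1.1] [cite: Kraus1989, Prop. 2] -/
theorem Rank3Row.isGloballyMinimal_of_mem {r : Rank3Row} (hr : r ∈ rank3Table) :
    r.curve.IsGloballyMinimal := by
  rw [← List.take_append_drop 2400 rank3Table] at hr
  rcases List.mem_append.mp hr with h | hr
  · exact isGloballyMinimal_of_totalMinCheck _ _ _ _ rank3Table_totalMinCheck₁ r h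
  rw [← List.take_append_drop 2400 (rank3Table.drop 2400)] at hr
  rcases List.mem_append.mp hr with h | hr
  · exact isGloballyMinimal_of_totalMinCheck _ _ _ _ rank3Table_totalMinCheck₂ r h
  rw [← List.take_append_drop 2400 ((rank3Table.drop 2400).drop 2400)] at hr
  rcases List.mem_append.mp hr with h | h
  · exact isGloballyMinimal_of_totalMinCheck _ _ _ _ rank3Table_totalMinCheck₃ r h
  · exact isGloballyMinimal_of_totalMinCheck _ _ _ _ rank3Table_totalMinCheck₄ r h

/-- **`L′(E,1) = 0` over `K = ℚ(√D)` for EVERY rank-3 row, `hmin` discharged**: the census headline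
`Rank3Row.rank3_lderiv_eq_zero_kernel` without its minimality hypothesis (`hw`, `hN` kept by name).
[cite: GrossLMS1991, (1.1) and Thm. 1.3] -/
theorem Rank3Row.rank3_lderiv_eq_zero_kernel₀ {r : Rank3Row} (hr : r ∈ rank3Table) (K : Type)
    [Field K] [NumberField K] (hE : WeierstrassCurve.hasEntireLFunction_rat)
    (hGZKK : mordellWeilRank_eq_one_of_LDerivEK_ne_zero r.curve K)
    (hN : r.curve.conductorNorm ℤ = r.N) (hK : IsImaginaryQuadratic K) (hdK : NumberField.discr K = r.D)
    (hw : r.curve.rootNumber = -1) (hLD : (r.curve.quadraticTwist (r.D : ℚ)).entireLFunction 1 ≠ 0) :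
    deriv r.curve.entireLFunction 1 = 0 :=
  Rank3Row.rank3_lderiv_eq_zero_kernel hr K hE hGZKK (Rank3Row.isGloballyMinimal_of_mem hr) hN hK hdK
    hw hLD

/-- **Fully certified form** for a row with root-number and conductor certificates: `hw` reduced to the
named fact `hKD`, `hN` to the five conductor facts, `hmin` DISCHARGED outright.
[cite: GrossLMS1991, (1.1) and Thm. 1.3] [cite: KellockDokchitser2023, Thm. 2.3 and §5] -/
theorem Rank3Row.rank3_lderiv_eq_zero_kernel_rnN₀ {r : Rank3Row} (hr : r ∈ rank3Table)
    (hrc : r.RootNumberCertified) (hcc : r.ConductorCertified) (K : Type) [Field K] [NumberField K]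
    (hE : WeierstrassCurve.hasEntireLFunction_rat)
    (hGZKK : mordellWeilRank_eq_one_of_LDerivEK_ne_zero r.curve K)
    (h0 : ∀ v : HeightOneSpectrum ℤ, conductorExponent_eq_zero_iff v r.curve)
    (h1 : ∀ v : HeightOneSpectrum ℤ, conductorExponent_eq_one_iff v r.curve)
    (h2 : ∀ v : HeightOneSpectrum ℤ, two_le_conductorExponent_iff v r.curve)
    (h5 : ∀ v : HeightOneSpectrum ℤ, conductorExponent_le_two_of_five_le_natGenerator r.curve v)
    (hf : ∀ v : HeightOneSpectrum ℤ, factorization_conductorNorm r.curve v)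
    (hK : IsImaginaryQuadratic K) (hdK : NumberField.discr K = r.D)
    (hKD : r.curve.rootNumber_eq_neg_finprod_tableLocalRootNumberAt')
    (hLD : (r.curve.quadraticTwist (r.D : ℚ)).entireLFunction 1 ≠ 0) :
    deriv r.curve.entireLFunction 1 = 0 :=
  Rank3Row.rank3_lderiv_eq_zero_kernel_rnN hr hrc hcc K hE hGZKK (Rank3Row.isGloballyMinimal_of_mem hr)
    h0 h1 h2 h5 hf hK hdK hKD hLD

/-- Row `0` (`5077a1`) and row `28` (`27584bd1`, a Kraus row): globally minimal by table membership
alone. [cite: CremonaAlgorithms1997, Tables] -/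
example : (rank3Table[0]'(by rw [rank3Table_length]; norm_num)).curve.IsGloballyMinimal :=
  Rank3Row.isGloballyMinimal_of_mem (List.getElem_mem _)

example : (rank3Table[28]'(by rw [rank3Table_length]; norm_num)).curve.IsGloballyMinimal :=
  Rank3Row.isGloballyMinimal_of_mem (List.getElem_mem _)

end Summit.BirchSwinnertonDyer.BirchSwinnertonDyer.Rank2Observatory
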